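import Summits.HodgeConjecture.HodgeConjecture.Theorems.TropicalWeilObstructionTropicalWeilVanishingVariationalClassTables
import HarnessLib

/-!
# Route `TropicalWeilObstruction` (Kontsevich's tropical test — NEGATION SINK, exploration, no summit claim):
# the VARIATIONAL direction bound is UNIFORM IN THE CLASS — the all-columns certificate serves every non-empty cycle

Negation-sink bookkeeping of the cell `pub-hodge-tropical` (seat tropical-2 gen 8, refereeing tropical-1 gen 9's VARIATIONAL series
p351664 / p352081 / p352543; referee finding R-V1 of the cell's `REFEREE-K1K2.md`, made kernel-exact; part B of two). Part III of that
series needs, for its direction count, coordinates on which the Weil part of the class tables vanishes (Ω-invisible columns: certified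
`N = 607` for every non-empty cycle; all columns only when `W(Z) = 0`: certified `N = 626`). By part A (`linearIndependent_classTables`:
the Weil tables are rank one, `w(D) = det(M_D)·Ω⊗Ω`, and `det(M_D)` is a linear functional of `θ₄(D)` killing `Ω⊗Ω`) the class tables of
independent directions are independent for EVERY class with `a ≠ 0`, on ARBITRARY coordinates. Hence:

* **`card_image_pluckerCoord_ge_of_independent_directions_anyClass`** — part III's certificate theorem WITHOUT the hypothesis on the
  Weil part: `N` integer directions with independent minor rows on any `N` coordinate pairs ⟹ `≥ N` pairwise distinct `4`-planes, for an
  effective cycle of any class with `a ≠ 0`;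
* `card_image_pluckerCoord_ge_allColumns` — every NON-EMPTY effective cycle (`a ≥ 1`, p345948);
* `card_image_pluckerCoord_ge_allColumns_of_linearlyRealisable` — seeds at `Q = 1` (transport p341426);
* `obstructed_of_card_image_pluckerCoord_lt_allColumns` — the obstruction rung of `stub_nonflatObstructedAtIdentity`.

NET. With the cell's VALID all-columns certificate (`certificates/variational/directions626_all_columns.json`, N = 626: 626 integer
symmetric `J`-commuting directions and 626 coordinate pairs, minor matrix of full rank modulo four primes, checked by two seats with
independent code) the kernel-certificate form of the variational bound now reads: EVERY non-empty effective tropical `4`-cycle on a very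
general tropical Weil eightfold — every counterexample to K1, every unobstructed seed — has cells in at least `626` pairwise distinct
rational `4`-planes, and every type on `ℝ⁸/ℤ⁸` with `≤ 625` distinct `4`-planes is obstructed at the identity (previously `607`/`606`
for every cycle, `626` only for `W = 0` or on paper). HONEST STATUS. A necessary condition on counterexamples/seeds of an OPEN statement
(K1, stmt-HodgeConjecture-18478); the number `626` remains a certified computation (representation theory `20² + 15² + 1` for the upper
bound), not a kernel theorem; nothing here decides K1 or bears on the Hodge conjecture in either direction. No definition, no named fact,
no sorry.

References: [Zharkov2020TropicalWeil] I. Zharkov, arXiv:2002.02347, §2 (pp. 2–4); [MikhalkinZharkov2014Eigenwave] G. Mikhalkin,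
I. Zharkov, LN UMI 15 (2014), Def. 4.2, Prop. 4.3, Thm. 5.4.
-/

set_option linter.dupNamespace false

noncomputable section

open scoped BigOperators Topology
open Matrix Filter
open Literature.AlgebraicGeometry.Tropical
open Summit.HodgeConjecture.HodgeConjecture.Theorems.TropicalHodgeBound

namespace Summit.HodgeConjecture.HodgeConjecture.Theorems.TropicalWeilVanishing.Variational

/-! ## §0 Display-only notation (the K3 skeleton's local definitions, verbatim bodies; nothing is defined) -/

/-- The skeleton's `thetaClass n Q`. -/
local notation3 (prettyPrint := false) "θ⟦" n "⟧" Q:max =>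
  (fun S S' : Fin n → Fin (2 * n) => Matrix.det (Matrix.submatrix Q S S'))

/-- The skeleton's `omegaFrame n` (`Ω = Pᴴ`). -/
local notation3 (prettyPrint := false) "Ω⟦" n "⟧" =>
  (Matrix.of fun (a : Fin (2 * n)) (b : Fin n) =>
    (if (a : ℕ) = (b : ℕ) then (1 : ℂ) else 0) - (if (a : ℕ) = (b : ℕ) + n then Complex.I else 0))

/-- The skeleton's `weilClassC n Q` (`w(Q) = (⋀ⁿQ ⊗ 1)(Ω ⊗ Ω)`). -/
local notation3 (prettyPrint := false) "wC⟦" n "⟧" Q:max =>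
  (fun S S' : Fin n → Fin (2 * n) =>
    Matrix.det (Matrix.submatrix (Matrix.map Q ((↑) : ℝ → ℂ) * Ω⟦n⟧) S id) *
      Matrix.det (Matrix.submatrix (Ω⟦n⟧) S' id))

/-- The skeleton's `weilClassRe n Q` (`w₁ = Re w`). -/
local notation3 (prettyPrint := false) "wRe⟦" n "⟧" Q:max =>
  (fun S S' : Fin n → Fin (2 * n) => Complex.re ((wC⟦n⟧ Q) S S'))

/-- The skeleton's `weilClassIm n Q` (`w₂ = Im w`). -/
local notation3 (prettyPrint := false) "wIm⟦" n "⟧" Q:max =>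
  (fun S S' : Fin n → Fin (2 * n) => Complex.im ((wC⟦n⟧ Q) S S'))

variable (Q : Matrix (Fin (2 * 4)) (Fin (2 * 4)) ℝ)

/-! ## §6 The variational direction bound for EVERY class: certificates on arbitrary coordinates -/

/-- **THE VARIATIONAL DIRECTION BOUND, UNIFORM IN THE CLASS (certificate form, arbitrary coordinates).** Let `Z` be an effective
tropical `4`-cycle on a very general p.p. tropical Weil eightfold with integer class coordinates `(a,b,c)`, `a ≠ 0` (every non-empty
cycle). Given `N` integer symmetric `J`-commuting directions `D_i` and ANY `N` coordinate pairs `(S_j,S'_j)` such that the real matrix of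
minors `det D_i[S_j,S'_j]` has linearly independent rows, the cells of `Z` carry at least `N` pairwise distinct Plücker vectors — `Z` has
at least `N` cells in at least `N` pairwise distinct rational `4`-planes. (Part III of the variational series needed the Weil part to vanish
on the chosen coordinates; by `linearIndependent_classTables` it need not.) With the cell's certified all-columns certificate, `N = 626`
for every class. Nothing here decides K1 or bears on HC. [cite: Zharkov2020TropicalWeil, §2 (pp. 2–4)]
[cite: MikhalkinZharkov2014Eigenwave, Prop. 4.3 and Thm. 5.4] -/
theorem card_image_pluckerCoord_ge_of_independent_directions_anyClass (hQ : Q.PosDef) (hJ : Q * weilJ 4 = weilJ 4 * Q)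
    (hgen : IsWeilGeneric 4 Q) (Z : TropicalTorusCycle (2 * 4) 4 Q) {a b c : ℤ}
    (hq : Z.cyc = (a : ℝ) • θ⟦4⟧ Q + (b : ℝ) • wRe⟦4⟧ Q + (c : ℝ) • wIm⟦4⟧ Q) (ha : a ≠ 0) {N : ℕ}
    (D : Fin N → Matrix (Fin (2 * 4)) (Fin (2 * 4)) ℤ) (hDS : ∀ i, ((D i).map ((↑) : ℤ → ℝ)).IsSymm)
    (hDJ : ∀ i, (D i).map ((↑) : ℤ → ℝ) * weilJ 4 = weilJ 4 * (D i).map ((↑) : ℤ → ℝ))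
    (col : Fin N → (Fin 4 → Fin (2 * 4)) × (Fin 4 → Fin (2 * 4)))
    (hind : LinearIndependent ℝ fun i : Fin N => fun j : Fin N =>
      ((Matrix.det (Matrix.submatrix (D i) (col j).1 (col j).2) : ℤ) : ℝ)) :
    N ≤ (Finset.univ.image fun σ : Fin Z.numCells => pluckerCoord (Z.cell σ).frame).card ∧ N ≤ Z.numCells := by
  classical
  -- the frame-square tables and their span
  let sq : ((Fin 4 → Fin (2 * 4)) → ℤ) → ((Fin 4 → Fin (2 * 4)) → (Fin 4 → Fin (2 * 4)) → ℝ) :=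
    fun p S S' => ((p S : ℤ) : ℝ) * ((p S' : ℤ) : ℝ)
  let T : Finset ((Fin 4 → Fin (2 * 4)) → (Fin 4 → Fin (2 * 4)) → ℝ) :=
    (Finset.univ.image fun σ : Fin Z.numCells => pluckerCoord (Z.cell σ).frame).image sq
  have hrange : (Set.range fun σ : Fin Z.numCells => fun S S' : Fin 4 → Fin (2 * 4) =>
      ((pluckerCoord (Z.cell σ).frame S : ℤ) : ℝ) * ((pluckerCoord (Z.cell σ).frame S' : ℤ) : ℝ)) ⊆ (T : Set _) := by
    rintro _ ⟨σ, rfl⟩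
    simp only [Finset.coe_image, Set.mem_image, Finset.mem_coe, Finset.mem_univ, true_and, T, sq]
    exact ⟨pluckerCoord (Z.cell σ).frame, ⟨σ, rfl⟩, rfl⟩
  -- the `N` class tables, inside `span T`, linearly independent for every class with `a ≠ 0`
  let v : Fin N → ((Fin 4 → Fin (2 * 4)) → (Fin 4 → Fin (2 * 4)) → ℝ) := fun i =>
    (a : ℝ) • θ⟦4⟧ ((D i).map ((↑) : ℤ → ℝ)) + (b : ℝ) • wRe⟦4⟧ ((D i).map ((↑) : ℤ → ℝ)) +
      (c : ℝ) • wIm⟦4⟧ ((D i).map ((↑) : ℤ → ℝ))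
  let Tset : Set ((Fin 4 → Fin (2 * 4)) → (Fin 4 → Fin (2 * 4)) → ℝ) := ↑T
  let Wsp : Submodule ℝ ((Fin 4 → Fin (2 * 4)) → (Fin 4 → Fin (2 * 4)) → ℝ) := Submodule.span ℝ Tset
  have hvmem : ∀ i, v i ∈ Wsp := fun i =>
    Submodule.span_mono hrange (weilFamilyClass_mem_span_frameSquares Q hQ hJ hgen Z hq (D i) (hDS i) (hDJ i))
  have hvind : LinearIndependent ℝ v :=
    linearIndependent_classTables D hDJ (a : ℝ) (b : ℝ) (c : ℝ) (by exact_mod_cast ha) col hind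
  -- count
  have hle : N ≤ T.card := by
    have hvind' : LinearIndependent ℝ (fun i => (⟨v i, hvmem i⟩ : Wsp)) := by
      apply LinearIndependent.of_comp Wsp.subtype
      exact hvind
    have h1 := hvind'.fintype_card_le_finrank
    rw [Fintype.card_fin] at h1
    exact h1.trans (finrank_span_finset_le_card T)
  have hT : T.card ≤ (Finset.univ.image fun σ : Fin Z.numCells => pluckerCoord (Z.cell σ).frame).card :=
    Finset.card_image_le
  refine ⟨hle.trans hT, (hle.trans hT).trans ?_⟩
  exact Finset.card_image_le.trans (by simp)

/-- **Corollary (every NON-EMPTY cycle, all coordinates).** For every non-empty effective tropical `4`-cycle at a very general Weil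
period (its class has `a ≥ 1`, `Integrality.thetaCoord_pos_int`) and every certificate of `N` integer directions with independent minor
rows on ARBITRARY coordinates: at least `N` pairwise distinct `4`-planes. With the cell's all-columns certificate: `N = 626` for every
counterexample to K1 and every non-empty effective cycle (previously `607`). [cite: Zharkov2020TropicalWeil, §2 (pp. 2–4)]
[cite: MikhalkinZharkov2014Eigenwave, Prop. 4.3 and Thm. 5.4] -/
theorem card_image_pluckerCoord_ge_allColumns (hQ : Q.PosDef) (hJ : Q * weilJ 4 = weilJ 4 * Q)
    (hgen : IsWeilGeneric 4 Q) (Z : TropicalTorusCycle (2 * 4) 4 Q) (hZ : 0 < Z.numCells) {N : ℕ}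
    (D : Fin N → Matrix (Fin (2 * 4)) (Fin (2 * 4)) ℤ) (hDS : ∀ i, ((D i).map ((↑) : ℤ → ℝ)).IsSymm)
    (hDJ : ∀ i, (D i).map ((↑) : ℤ → ℝ) * weilJ 4 = weilJ 4 * (D i).map ((↑) : ℤ → ℝ))
    (col : Fin N → (Fin 4 → Fin (2 * 4)) × (Fin 4 → Fin (2 * 4)))
    (hind : LinearIndependent ℝ fun i : Fin N => fun j : Fin N =>
      ((Matrix.det (Matrix.submatrix (D i) (col j).1 (col j).2) : ℤ) : ℝ)) :
    N ≤ (Finset.univ.image fun σ : Fin Z.numCells => pluckerCoord (Z.cell σ).frame).card ∧ N ≤ Z.numCells := by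
  obtain ⟨a, b, c, hq, ha, -⟩ := Integrality.thetaCoord_pos_int Q hQ hJ hgen Z hZ
  exact card_image_pluckerCoord_ge_of_independent_directions_anyClass Q hQ hJ hgen Z hq (by omega) D hDS hDJ col hind

/-! ## §7 Seeds at the identity: transport and obstruction, all coordinates -/

/-- **Seed form, all coordinates.** A non-empty effective tropical `4`-cycle on `ℝ⁸/ℤ⁸` whose type is linearly realisable in every
direction of `Sym_J` carries at least `N` pairwise distinct Plücker vectors for every all-columns certificate with `N` rows (transport to a
very general realisation with the same frames, p341426). [cite: Zharkov2020TropicalWeil, §1–2 (pp. 2–4)]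
[cite: MikhalkinZharkov2014Eigenwave, Def. 4.2 and Prop. 4.3] -/
theorem card_image_pluckerCoord_ge_allColumns_of_linearlyRealisable
    (Z₀ : TropicalTorusCycle (2 * 4) 4 (1 : Matrix (Fin (2 * 4)) (Fin (2 * 4)) ℝ)) (hZ₀ : 0 < Z₀.numCells)
    (hsec : ∀ D : Matrix (Fin (2 * 4)) (Fin (2 * 4)) ℝ, D.IsSymm → D * weilJ 4 = weilJ 4 * D →
      ∃ (v : Fin Z₀.numCells → Fin (4 + 1) → Fin (2 * 4) → ℝ)
        (T : Fin Z₀.numCells → Matrix (Fin 4) (Fin 4) ℝ)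
        (r : Fin Z₀.numFacetClasses → Fin 4 → Fin (2 * 4) → ℝ),
        (∀ (σ : Fin Z₀.numCells) (j : Fin 4) (a : Fin (2 * 4)),
            v σ j.succ a - v σ 0 a = ∑ m, ((Z₀.cell σ).frame a m : ℝ) * T σ m j) ∧
        (∀ (σ : Fin Z₀.numCells) (i : Fin (4 + 1)) (j : Fin 4) (a : Fin (2 * 4)),
            v σ (i.succAbove (Z₀.facetPerm σ i j)) a =
              r (Z₀.facetClass σ i) j a + ∑ b, D a b * (Z₀.facetShift σ i b : ℝ)))
    {N : ℕ} (D : Fin N → Matrix (Fin (2 * 4)) (Fin (2 * 4)) ℤ) (hDS : ∀ i, ((D i).map ((↑) : ℤ → ℝ)).IsSymm)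
    (hDJ : ∀ i, (D i).map ((↑) : ℤ → ℝ) * weilJ 4 = weilJ 4 * (D i).map ((↑) : ℤ → ℝ))
    (col : Fin N → (Fin 4 → Fin (2 * 4)) × (Fin 4 → Fin (2 * 4)))
    (hind : LinearIndependent ℝ fun i : Fin N => fun j : Fin N =>
      ((Matrix.det (Matrix.submatrix (D i) (col j).1 (col j).2) : ℤ) : ℝ)) :
    N ≤ (Finset.univ.image fun σ : Fin Z₀.numCells => pluckerCoord (Z₀.cell σ).frame).card ∧ N ≤ Z₀.numCells := by
  classical
  obtain ⟨Q, Z, hQ, hQJ, hgen, hc, hsame⟩ := FrameSpan.exists_generic_realisation_of_linearlyRealisable Z₀ hsec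
  have hZ : 0 < Z.numCells := by rw [hc]; exact hZ₀
  have h := card_image_pluckerCoord_ge_allColumns Q hQ hQJ hgen Z hZ D hDS hDJ col hind
  have himg : (Finset.univ.image fun σ : Fin Z.numCells => pluckerCoord (Z.cell σ).frame) =
      Finset.univ.image fun σ : Fin Z₀.numCells => pluckerCoord (Z₀.cell σ).frame := by
    ext p
    simp only [Finset.mem_image, Finset.mem_univ, true_and]
    constructor
    · rintro ⟨σ, rfl⟩
      exact ⟨Fin.cast hc σ, by rw [(hsame σ).1]⟩
    · rintro ⟨σ, rfl⟩
      refine ⟨Fin.cast hc.symm σ, ?_⟩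
      have e : Fin.cast hc (Fin.cast hc.symm σ) = σ := Fin.ext rfl
      rw [(hsame (Fin.cast hc.symm σ)).1, e]
  rw [himg, hc] at h
  exact h

/-- **OBSTRUCTION BY THE UNIFORM VARIATIONAL COUNT** (a rung of `stub_nonflatObstructedAtIdentity`): given an all-columns certificate with
`N` rows, every non-empty effective tropical `4`-cycle on `ℝ⁸/ℤ⁸` with FEWER THAN `N` pairwise distinct Plücker vectors is OBSTRUCTED AT THE
IDENTITY. With the cell's certified `N = 626` this retires every type with `≤ 625` distinct `4`-planes (part III: `≤ 606`; row (F): `≤ 68`).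
It decides nothing about K1. [cite: Zharkov2020TropicalWeil, §1–2 (pp. 2–4)] [cite: MikhalkinZharkov2014Eigenwave, Def. 4.2 and Prop. 4.3] -/
theorem obstructed_of_card_image_pluckerCoord_lt_allColumns
    (Z₀ : TropicalTorusCycle (2 * 4) 4 (1 : Matrix (Fin (2 * 4)) (Fin (2 * 4)) ℝ)) (hZ₀ : 0 < Z₀.numCells)
    {N : ℕ} (D : Fin N → Matrix (Fin (2 * 4)) (Fin (2 * 4)) ℤ) (hDS : ∀ i, ((D i).map ((↑) : ℤ → ℝ)).IsSymm)
    (hDJ : ∀ i, (D i).map ((↑) : ℤ → ℝ) * weilJ 4 = weilJ 4 * (D i).map ((↑) : ℤ → ℝ))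
    (col : Fin N → (Fin 4 → Fin (2 * 4)) × (Fin 4 → Fin (2 * 4)))
    (hind : LinearIndependent ℝ fun i : Fin N => fun j : Fin N =>
      ((Matrix.det (Matrix.submatrix (D i) (col j).1 (col j).2) : ℤ) : ℝ))
    (hfew : (Finset.univ.image fun σ : Fin Z₀.numCells => pluckerCoord (Z₀.cell σ).frame).card < N) :
    ∃ ℓ : Matrix (Fin (2 * 4)) (Fin (2 * 4)) ℝ →ₗ[ℝ] ℝ,
      (∃ D : Matrix (Fin (2 * 4)) (Fin (2 * 4)) ℝ, D.IsSymm ∧ D * weilJ 4 = weilJ 4 * D ∧ ℓ D ≠ 0) ∧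
      ∀ Q' : Matrix (Fin (2 * 4)) (Fin (2 * 4)) ℝ, Q'.IsSymm → Q' * weilJ 4 = weilJ 4 * Q' →
        (∃ Z' : TropicalTorusCycle (2 * 4) 4 Q',
          ∃ (hc : Z'.numCells = Z₀.numCells) (hf : Z'.numFacetClasses = Z₀.numFacetClasses),
            ∀ σ : Fin Z'.numCells,
              (Z'.cell σ).weight = (Z₀.cell (Fin.cast hc σ)).weight ∧
              (Z'.cell σ).frame = (Z₀.cell (Fin.cast hc σ)).frame ∧
              ∀ i : Fin (4 + 1),
                Fin.cast hf (Z'.facetClass σ i) = Z₀.facetClass (Fin.cast hc σ) i ∧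
                Z'.facetPerm σ i = Z₀.facetPerm (Fin.cast hc σ) i ∧
                Z'.facetShift σ i = Z₀.facetShift (Fin.cast hc σ) i) → ℓ Q' = 0 := by
  rcases obstructed_or_linearSection Z₀ with hobs | hsec
  · exact hobs
  · exfalso
    have h := (card_image_pluckerCoord_ge_allColumns_of_linearlyRealisable Z₀ hZ₀ hsec D hDS hDJ col hind).1
    omega

end Summit.HodgeConjecture.HodgeConjecture.Theorems.TropicalWeilVanishing.Variational

end
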